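import Summits.QuantumFields.BalabanUV.T4Continuum.Support.ShellMeasureLandauHolonomyClamp
import Summits.QuantumFields.BalabanUV.T4Continuum.Support.ShellMeasureLandauHolonomyWeight
import Summits.QuantumFields.BalabanUV.T4Continuum.Support.ShellMeasureRayTermsAlong

/-!
# `T4Continuum.ShellMeasureLandauHolonomyTermsEnd` — SM-L4's ray bound `hE` for a non-Wilson term DEFINED as the real
# part of per-term functionals of the canonical Landau exponent field, and THE S22 END WITH ALL THREE LEVEL
# FUNCTIONALS DEFINED (classifier holonomies `hol`, weight words `G`, non-Wilson term `𝓔`) from ONE exponent field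
(cell `pub-balaban`, sub-cell `t4`, spine estimate NE7c (node U5b); NE7c formalisation swarm, crew seat
`b2b-balaban-t4-ne7c-formalise-leaf-02` gen 4 — file (D) of the OFFER «S22 ROAD, THE WEIGHT SIDE»; imports
`ShellMeasureLandauHolonomyClamp` (leaf-05-g4, p213068), this lineage's `ShellMeasureLandauHolonomyWeight` (file (B),
p214220) and `ShellMeasureRayTermsAlong` (LD f4, p210904) ONLY; 0 `def`, 0 `def … : Prop`, 0 sorry)

HONEST FRAMING.  Finite four-torus programme, rung (B)+1 only — NOT infinite volume, NOT a mass gap, NOT the Clay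
problem, NOT summit progress; (B), `BetaPertHyp`, (B^μ) not consumed.  NE7c (`T4IndicatorShell.ShellWeightBound`) is
NOT PRINTED and NOT PROVED; «NE7c ⇐ the named binders»; (M1) realized ≠ NE7c (trigger c3).  Nothing printed in
[Balaban1985Variational] / [Balaban1987RG1] / [Balaban1988RG2Cluster] is asserted: the per-term functional pairs
((1.18)/(2.31) TYPE: Fréchet-analytic on a ball `‖Z‖ < r_E` with sup bounds `e_i`, summable `Σ 2e_i ≤ H̄` — located,
S6 verdict), the coupling `z̄ ≤ r_E` («the ray's Landau configurations lie in the terms' domain»), the S22 data, the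
real structure and the unitarity type of the weight read-outs are DISPLAYED-TYPE binders; SM-L1/L3/L4 are NOT minted
(c2) — they are INHABITED, in END-II's own shapes, by DEFINITIONS from these binders.

WHAT THIS FILE DOES.
* §1 `landauCurve_mapsTo` — the canonical Landau exponent along a holomorphic datum curve maps the disc into the
  terms' ball `‖Z‖ < r_E` under the coupling `(ε₄+a) + 4C₂B₀(ε₄+a)² ≤ r_E` (file (B)'s `landauCurve_along`, strict form).
* §2 `hE_landau_chartRay` — END-II's SM-L4 binder `hE`, literally, for the DEFINED non-Wilson term
  `𝓔 := fun y => (Σ_{i∈I} 𝓔_i (Z y)).re` (Z the exponent field of 7″ §3), `B_𝓔 = 3H̄/(r_Φ/S − 1)`: this lineage's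
  `ShellMeasureRayTermsAlong.hE_of_functionals_along` (hence S16's `rayBound_of_analytic_terms`) BY NAME on the chart
  rays, the 𝓔-dictionary DISCHARGED by ray-consistency; `hB𝓔_landau` — `0 ≤ B_𝓔`.
* §3 `slotAC_realized_su2_landauChart_threeSided` — E2′ (`ShellMeasureLandauHolonomyClamp.slotAC_realized_su2_of_
  levelData_cube_contOn`) with `hol`, `hcont`, `hRad`, `hAN` (7″ + Continuity), `G`, `hGW` (file (B)) AND `𝓔`, `hE`,
  `hB𝓔` (§2) NO LONGER BINDERS.  Remaining binders of the realized (M1) of one live slot on the S22 road: the measure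
  side of E2′; the two DICTIONARIES `hRdict` (block weight = `Jco · e^{−S}`, `S` built from the DEFINED `G` and `𝓔`)
  and `hudict` (tested variable = classifier of the DEFINED `hol`); co-tests `hJW`/`hJ`, `hWS`; numbers, SM-L2 `hSM`,
  the weight smallness `hsw1`; the S22 scheme data per `V` (V-uniform constants); the per-term functional data; the
  real structure; the unitarity type.  CONCLUSION: E2′'s, literally, with constant
  `2(n + β Σ_{p∈P_w} L̄(0 + 4s̄) + 3H̄/(r_Φ/S − 1))/(1−δ)`.
NOT an instance of Bałaban's minimiser / effective action (no binder is discharged); NE7c NOT PROVED; spine PROVED 0/9.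
HONEST DEPENDENCY (cell): continuum YM on T⁴ ⇐ BetaPertH ∧ nine spine estimates (0/9 proved); BetaPertH ⇐ (D1) ∧ (D4)
∧ CAP+tail; G-an2-4 gates asym, D1 and NE2/3/4.
-/

noncomputable section

open Set Metric NormedSpace MeasureTheory Function

namespace Summit.QuantumFields.BalabanUV.T4Continuum.ShellMeasureLandauHolonomyTermsEnd

open scoped ENNReal
open Literature.MathematicalPhysics.QuantumFieldTheory.Balaban1983to89
open B11Prop6Scheme (Prop4Hyp norm_arg_lt)
open GaugeField (GaugeInvariant)
open T4ShellMeasure (SlotAntiConcentration)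
open T4CubePoincare (cube)
open T4CubeChartGnomonic (SU2)
open T4CubeChartExp (expWindowDensity expFibreChart)
open T4ShellMeasureDet (blockLaw)
open T4TreeGaugeFixing (NoClosedLoop fixTo)
open ShellMeasureWilsonTrace (TraceData)
open ShellMeasureLevelAssembly (classifier weight)
open ShellMeasureLandauExponent (currentData_zero)
open ShellMeasureLandauHolonomy (solAt corrAt landauExp landauExp_apply solAt_along corrAt_along)
open ShellMeasureLandauHolonomyChart (holOf cplx ofReal_smul_cplx rayData_chart hAN_landau_chartRay)
open ShellMeasureLandauHolonomyContinuity (continuousOn_landauHol_chartRay)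
open ShellMeasureLandauHolonomyClamp (slotAC_realized_su2_of_levelData_cube_contOn)
open ShellMeasureLandauHolonomyWeight (landauCurve_along hGW_landau_chartRay)
open ShellMeasureRayTermsAlong (termCurve_of_functional hE_of_functionals_along hB𝓔_of_functionals)

variable {𝒴 𝒴' 𝒳 𝒵 ℬ : Type*} [NormedAddCommGroup 𝒴] [NormedSpace ℂ 𝒴] [CompleteSpace 𝒴]
  [NormedAddCommGroup 𝒴'] [NormedSpace ℂ 𝒴'] [NormedAddCommGroup 𝒳] [NormedSpace ℂ 𝒳] [CompleteSpace 𝒳]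
  [NormedAddCommGroup 𝒵] [NormedSpace ℂ 𝒵] [NormedAddCommGroup ℬ] [NormedSpace ℂ ℬ]

/-! ## §1 The Landau curve maps the disc into the terms' domain -/

section Curve

variable {𝒢 : 𝒵 →L[ℂ] 𝒴} {Λ : 𝒴 →L[ℂ] 𝒴} {W𝒱 : 𝒴 → 𝒵} {B₀ θ C₄ a₃ : ℝ}

omit [NormedAddCommGroup ℬ] [NormedSpace ℂ ℬ] in
/-- **THE CANONICAL LANDAU EXPONENT ALONG A DATUM CURVE LIES IN THE TERMS' BALL.**  Under the S22 binders of file (B)'s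
`landauCurve_along` and the located coupling `(ε₄+a) + 4C₂B₀(ε₄+a)² ≤ r_E`, the curve
`σ ↦ landauExp C ι H (4C₂(ε₄+a)²) (solAt 𝒢 Λ W𝒱 ε₄ (J_σ) (𝔄_σ) + 𝔄_σ)` maps the disc `‖σ‖ < Rad` into `ball 0 r_E`
(strictly: `‖𝒜₁(σ) + 𝔄_σ‖ < ε₄ + a`). [folklore] -/
theorem landauCurve_mapsTo (h𝒢 : ∀ f, ‖𝒢 f‖ ≤ B₀ * ‖f‖) (hΛ : ∀ Y, ‖Λ Y‖ ≤ θ * ‖Y‖)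
    (hW : Prop4Hyp W𝒱 C₄ a₃) (hB₀ : 0 ≤ B₀) (hC₄ : 0 ≤ C₄) (hθ : 0 ≤ θ) {j a ε₄ : ℝ} (hε₄ : 0 ≤ ε₄)
    (hdom : 2 * (ε₄ + a) ≤ a₃) (hself : B₀ * j + θ * (ε₄ + a) + B₀ * C₄ * (ε₄ + a) ^ 2 ≤ ε₄)
    (hcontr : θ + 4 * B₀ * C₄ * (ε₄ + a) < 1) {Rad : ℝ} (hRad : 0 < Rad) {Jf : ℂ → 𝒵} {𝔄f : ℂ → 𝒴}
    (hJd : DifferentiableOn ℂ Jf (ball 0 Rad)) (h𝔄d : DifferentiableOn ℂ 𝔄f (ball 0 Rad))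
    (hJ : ∀ σ ∈ ball (0 : ℂ) Rad, ‖Jf σ‖ ≤ j) (h𝔄 : ∀ σ ∈ ball (0 : ℂ) Rad, ‖𝔄f σ‖ < a)
    (hJ0 : Jf 0 = 0) (h𝔄0 : 𝔄f 0 = 0)
    {C : 𝒴' → 𝒳} {C₂ R : ℝ} (hC₂ : 0 ≤ C₂) (hCq : ∀ Z : 𝒴', ‖Z‖ < R → ‖C Z‖ ≤ C₂ * ‖Z‖ ^ 2)
    (hCd : DifferentiableOn ℂ C (ball 0 R)) (ι : 𝒴 →L[ℂ] 𝒴') (hι : ∀ Y, ‖ι Y‖ ≤ ‖Y‖) (H : 𝒳 →L[ℂ] 𝒴)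
    (hH : ∀ X, ‖H X‖ ≤ B₀ * ‖X‖) (hq : 9 * C₂ * B₀ * (ε₄ + a) < 1) (hRC : 3 * (ε₄ + a) ≤ R)
    {rE : ℝ} (hcoupE : (ε₄ + a) + B₀ * (4 * C₂ * (ε₄ + a) ^ 2) ≤ rE) :
    MapsTo (fun σ => landauExp C ι H (4 * C₂ * (ε₄ + a) ^ 2) (solAt 𝒢 Λ W𝒱 ε₄ (Jf σ) (𝔄f σ) + 𝔄f σ))
      (ball (0 : ℂ) Rad) (ball (0 : 𝒴) rE) := by
  obtain ⟨hXd, hX, -⟩ := solAt_along h𝒢 hΛ hW hB₀ hC₄ hθ hε₄ hdom hself hcontr hRad hJd h𝔄d hJ h𝔄 hJ0 h𝔄0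
  have hYd : DifferentiableOn ℂ (fun σ => solAt 𝒢 Λ W𝒱 ε₄ (Jf σ) (𝔄f σ) + 𝔄f σ) (ball 0 Rad) := hXd.add h𝔄d
  have hY : ∀ σ ∈ ball (0 : ℂ) Rad, ‖solAt 𝒢 Λ W𝒱 ε₄ (Jf σ) (𝔄f σ) + 𝔄f σ‖ < ε₄ + a := fun σ hσ =>
    norm_arg_lt (h𝔄 σ hσ) (hX σ hσ).1
  obtain ⟨-, hD⟩ := corrAt_along hC₂ hCq hCd ι hι H hB₀ hH hq hRC hYd hY
  intro σ hσ
  dsimp only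
  rw [mem_ball_zero_iff, landauExp_apply]
  have hDb : ‖corrAt C ι H (4 * C₂ * (ε₄ + a) ^ 2) (solAt 𝒢 Λ W𝒱 ε₄ (Jf σ) (𝔄f σ) + 𝔄f σ)‖ ≤
      4 * C₂ * (ε₄ + a) ^ 2 := mem_closedBall_zero_iff.1 (hD σ hσ).1
  calc _ ≤ ‖solAt 𝒢 Λ W𝒱 ε₄ (Jf σ) (𝔄f σ) + 𝔄f σ‖ +
        ‖H (corrAt C ι H (4 * C₂ * (ε₄ + a) ^ 2) (solAt 𝒢 Λ W𝒱 ε₄ (Jf σ) (𝔄f σ) + 𝔄f σ))‖ := norm_sub_le _ _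
    _ < (ε₄ + a) + B₀ * (4 * C₂ * (ε₄ + a) ^ 2) :=
        add_lt_add_of_lt_of_le (hY σ hσ) ((hH _).trans (mul_le_mul_of_nonneg_left hDb hB₀))
    _ ≤ rE := hcoupE

end Curve

/-! ## §2 END-II's `hE` on the chart-ray instance for the DEFINED non-Wilson term -/

section ChartRay

variable {n : ℕ} {𝒢 : 𝒵 →L[ℂ] 𝒴} {W𝒱 : 𝒴 → 𝒵} {B₀ C₄ a₃ : ℝ}

/-- **END-II's SM-L4 BINDER `hE` FOR THE DEFINED NON-WILSON TERM — PER-TERM FUNCTIONAL PAIRS, NO 𝓔-DICTIONARY.**  Chart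
space `Fin n → ℝ`, window `W ⊆ closedBall 0 S`, `0 < S < r_Φ`; the S22 point/ray data of 7″ §3 ((P2) `h𝒢`; (P4)
`hW`; (118)/(121); (103) `hH₁`; (75) `hΦd`/`hΦ0`/`hΦ`; (44)+[4] Prop. 7 `hCq`/`hCd`; scaling `hι`; (46) `hH`; (54)
`hq`/`hRC`); the PER-TERM FUNCTIONAL PAIRS of `ShellMeasureRayTermsAlong` — a finite set `I` of `𝓔_i : 𝒴 → ℂ`,
Fréchet-analytic on `ball 0 r_E` with sup bounds `e_i`, `Σ_{i∈I} 2e_i ≤ H̄` ((1.18)/(2.31) TYPE, located) — and the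
located coupling `z̄ = (ε₄+B₀b) + 4C₂B₀(ε₄+B₀b)² ≤ r_E`.  CONCLUSION: END-II's `hE`, literally, for the DEFINED term
`𝓔 := fun y => (Σ_{i∈I} 𝓔_i (landauExp C ι H (4C₂(ε₄+B₀b)²) (solAt 𝒢 0 W𝒱 ε₄ 0 (H₁ (Φ (cplx y))) + H₁ (Φ (cplx y))))).re`
with `B_𝓔 = 3H̄/(r_Φ/S − 1)` (`hE_of_functionals_along` BY NAME; the 𝓔-dictionary holds by ray-consistency). [folklore] -/
theorem hE_landau_chartRay {W : Set (Fin n → ℝ)} {S : ℝ} (hS : 0 < S) (hWS : W ⊆ closedBall (0 : Fin n → ℝ) S)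
    (h𝒢 : ∀ f, ‖𝒢 f‖ ≤ B₀ * ‖f‖) (hW : Prop4Hyp W𝒱 C₄ a₃) (hB₀ : 0 < B₀) (hC₄ : 0 ≤ C₄)
    {b ε₄ : ℝ} (hε₄ : 0 ≤ ε₄) (hdom : 2 * (ε₄ + B₀ * b) ≤ a₃)
    (hself : B₀ * C₄ * (ε₄ + B₀ * b) ^ 2 ≤ ε₄) (hcontr : 4 * B₀ * C₄ * (ε₄ + B₀ * b) < 1)
    (H₁ : ℬ →L[ℂ] 𝒴) (hH₁ : ∀ B, ‖H₁ B‖ ≤ B₀ * ‖B‖)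
    {Φ : (Fin n → ℂ) → ℬ} {rΦ : ℝ} (hΦd : DifferentiableOn ℂ Φ (ball 0 rΦ)) (hΦ0 : Φ 0 = 0)
    (hΦ : ∀ z ∈ ball (0 : Fin n → ℂ) rΦ, ‖Φ z‖ < b) (hSr : S < rΦ)
    {C : 𝒴' → 𝒳} {C₂ R : ℝ} (hC₂ : 0 ≤ C₂) (hCq : ∀ Z : 𝒴', ‖Z‖ < R → ‖C Z‖ ≤ C₂ * ‖Z‖ ^ 2)
    (hCd : DifferentiableOn ℂ C (ball 0 R)) (ι : 𝒴 →L[ℂ] 𝒴') (hι : ∀ Y, ‖ι Y‖ ≤ ‖Y‖) (H : 𝒳 →L[ℂ] 𝒴)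
    (hH : ∀ X, ‖H X‖ ≤ B₀ * ‖X‖) (hq : 9 * C₂ * B₀ * (ε₄ + B₀ * b) < 1) (hRC : 3 * (ε₄ + B₀ * b) ≤ R)
    -- the per-term functional pairs and the coupling
    {𝔱 : Type*} (I : Finset 𝔱) {Ef : 𝔱 → 𝒴 → ℂ} {rE : ℝ} {e : 𝔱 → ℝ} {Hbar : ℝ}
    (hEd : ∀ i ∈ I, DifferentiableOn ℂ (Ef i) (ball 0 rE))
    (hEb : ∀ i ∈ I, ∀ Z ∈ ball (0 : 𝒴) rE, ‖Ef i Z‖ ≤ e i) (hsum : ∑ i ∈ I, 2 * e i ≤ Hbar)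
    (hcoupE : (ε₄ + B₀ * b) + B₀ * (4 * C₂ * (ε₄ + B₀ * b) ^ 2) ≤ rE) :
    ∀ x ∈ W, ∀ c' : ℝ, 1 / 2 ≤ c' → c' ≤ 1 →
      (fun y => (∑ i ∈ I, Ef i (landauExp C ι H (4 * C₂ * (ε₄ + B₀ * b) ^ 2)
        (solAt 𝒢 0 W𝒱 ε₄ (0 : 𝒵) (H₁ (Φ (cplx y))) + H₁ (Φ (cplx y))))).re) (c' • x) ≤
      (fun y => (∑ i ∈ I, Ef i (landauExp C ι H (4 * C₂ * (ε₄ + B₀ * b) ^ 2)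
        (solAt 𝒢 0 W𝒱 ε₄ (0 : 𝒵) (H₁ (Φ (cplx y))) + H₁ (Φ (cplx y))))).re) x +
        (1 - c') * (3 * Hbar / (rΦ / S - 1)) := by
  have hRad1 : 1 < rΦ / S := by rw [lt_div_iff₀ hS]; linarith
  have hRad : 0 < rΦ / S := one_pos.trans hRad1
  have hΛ : ∀ Y : 𝒴, ‖(0 : 𝒴 →L[ℂ] 𝒴) Y‖ ≤ 0 * ‖Y‖ := fun Y => by simp
  have hself' : B₀ * 0 + 0 * (ε₄ + B₀ * b) + B₀ * C₄ * (ε₄ + B₀ * b) ^ 2 ≤ ε₄ := by simpa using hself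
  have hcontr' : 0 + 4 * B₀ * C₄ * (ε₄ + B₀ * b) < 1 := by simpa using hcontr
  have hray := fun x (hx : x ∈ W) =>
    rayData_chart H₁ hH₁ hB₀ hΦd hΦ0 hΦ hS (mem_closedBall_zero_iff.1 (hWS hx))
  have hcurve := fun x (hx : x ∈ W) =>
    landauCurve_along h𝒢 hΛ hW hB₀.le hC₄ le_rfl hε₄ hdom hself' hcontr' hRad
      (currentData_zero (𝒵 := 𝒵) (rΦ / S)).1 (hray x hx).1 (currentData_zero (𝒵 := 𝒵) (rΦ / S)).2.1
      (hray x hx).2.2.1 rfl (hray x hx).2.1 hC₂ hCq hCd ι hι H hH hq hRC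
  have hmaps := fun x (hx : x ∈ W) =>
    landauCurve_mapsTo h𝒢 hΛ hW hB₀.le hC₄ le_rfl hε₄ hdom hself' hcontr' hRad
      (currentData_zero (𝒵 := 𝒵) (rΦ / S)).1 (hray x hx).1 (currentData_zero (𝒵 := 𝒵) (rΦ / S)).2.1
      (hray x hx).2.2.1 rfl (hray x hx).2.1 hC₂ hCq hCd ι hι H hH hq hRC hcoupE
  exact hE_of_functionals_along I hEd hEb hsum hRad1 (fun x hx => (hcurve x hx).1) hmaps
    (𝓔 := fun y => (∑ i ∈ I, Ef i (landauExp C ι H (4 * C₂ * (ε₄ + B₀ * b) ^ 2)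
      (solAt 𝒢 0 W𝒱 ε₄ (0 : 𝒵) (H₁ (Φ (cplx y))) + H₁ (Φ (cplx y))))).re)
    (fun _ _ _ _ _ => by simp only [ofReal_smul_cplx])

omit [NormedSpace ℂ 𝒴] [CompleteSpace 𝒴] [NormedAddCommGroup 𝒴'] [NormedSpace ℂ 𝒴'] [NormedAddCommGroup 𝒳]
  [NormedSpace ℂ 𝒳] [CompleteSpace 𝒳] [NormedAddCommGroup 𝒵] [NormedSpace ℂ 𝒵] [NormedAddCommGroup ℬ] [NormedSpace ℂ ℬ] in
/-- `0 ≤ B_𝓔 = 3H̄/(r_Φ/S − 1)`: the sup bounds are nonnegative as soon as the terms' ball is non-empty (`0 < r_E`, here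
from the coupling and `0 < z̄`). [folklore] -/
theorem hB𝓔_landau {𝔱 : Type*} (I : Finset 𝔱) {Ef : 𝔱 → 𝒴 → ℂ} {rE zbar Hbar S rΦ : ℝ} {e : 𝔱 → ℝ}
    (hS : 0 < S) (hSr : S < rΦ) (hEb : ∀ i ∈ I, ∀ Z ∈ ball (0 : 𝒴) rE, ‖Ef i Z‖ ≤ e i)
    (hsum : ∑ i ∈ I, 2 * e i ≤ Hbar) (hz : 0 < zbar) (hcoupE : zbar ≤ rE) :
    0 ≤ 3 * Hbar / (rΦ / S - 1) := by
  have hRad1 : 1 < rΦ / S := by rw [lt_div_iff₀ hS]; linarith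
  have hrE : 0 < rE := hz.trans_le hcoupE
  exact hB𝓔_of_functionals I hRad1 (fun i hi => (norm_nonneg _).trans (hEb i hi 0 (mem_ball_self hrE))) hsum

end ChartRay

/-! ## §3 The S22 END with all three level functionals defined -/

section EndThree

variable {P : Params} {j : ℕ} [DecidableEq (PBond P j)]
variable {A : Type*} [NormedRing A] [NormedAlgebra ℂ A] [CompleteSpace A] [NormOneClass A]

/-- **REALIZED (M1) PER SLOT (`G = SU(2)`) WITH ALL THREE LEVEL FUNCTIONALS DEFINED FROM THE CANONICAL LANDAU EXPONENT
FIELD — E2′ WITH `hol`, `hcont`, `hRad`, `hAN`, `G`, `hGW`, `𝓔`, `hE`, `hB𝓔` NO LONGER BINDERS.**  See the module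
docstring for the remaining binder list.  With `Z_V y := landauExp (Cf V) (ιs V) (Hop V) (4C₂(ε₄+B₀b)²) (solAt (𝒢 V) 0
(W𝒱 V) ε₄ 0 (H₁ V (Φ V (cplx y))) + H₁ V (Φ V (cplx y)))` (written out below): classifier holonomies
`holOf (ℓs p) Z_V` (inside `hudict`), weight words `holOf (ℓw p) Z_V` and non-Wilson term `(Σ_{i∈I} 𝓔_i^V (Z_V y)).re`
(both inside `hRdict`).  CONCLUSION: E2′'s
`SlotAntiConcentration ((fieldMeasure P j SU2).withDensity F) u θ ρ (2(n + β Σ_{p∈P_w} L̄(0 + 4s̄) + 3H̄/(r_Φ/S−1))/(1−δ))`,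
`s̄ = m_w κ_w z̄`, `L̄ = 3 m_w κ_w z̄/(r_Φ/S − 1)`, `z̄ = (ε₄+B₀b) + 4C₂B₀(ε₄+B₀b)²`.  A junction; CONDITIONAL on every
binder; nothing PRINTED is asserted; NOT Bałaban's minimiser or effective action. [folklore] -/
theorem slotAC_realized_su2_landauChart_threeSided {T : Finset (PBond P j)} (hT : NoClosedLoop T)
    (U₀ : GaugeField P j SU2) (Λ : Finset (PBond P j)) {n : ℕ} (e : ↥Λ × Fin 3 ≃ Fin n)
    {S : ℝ} (hS : 0 < S) (hSπ : 3 * S ^ 2 < Real.pi ^ 2) (c : GaugeField P j SU2 → GaugeField P j SU2)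
    {R : GaugeField P j SU2 → (↥Λ → SU2) → ℝ≥0∞} (hR : ∀ V, Measurable (R V))
    {F : GaugeField P j SU2 → ℝ≥0∞} (hF : Measurable F) (hFi : GaugeInvariant F)
    (hFw : ∀ V y, F (fixTo T U₀ (updateFinset V Λ y)) =
      ENNReal.ofReal (expWindowDensity Λ (c V) S (updateFinset (c V) Λ y)) * R V y)
    (hfin : ∀ V, ((blockLaw Λ).withDensity fun y => F (fixTo T U₀ (updateFinset V Λ y))) univ ≠ ∞)
    {u : GaugeField P j SU2 → ℝ} (hu : Measurable u) (hui : GaugeInvariant u)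
    -- level data per exterior section: trace datum, plaquette index sets, window, co-test
    (Ttr : TraceData A) (hN : 0 < Ttr.N) {ι κ : Type*} {Pu : Finset ι} (hPu : Pu.Nonempty) (Pw : Finset κ)
    (W : GaugeField P j SU2 → Set (Fin n → ℝ)) (Jco : GaugeField P j SU2 → (Fin n → ℝ) → ℝ≥0∞)
    {θ δ ρ β : ℝ}
    -- THE SCHEME DATA per exterior section (S22: (P2), (P4), (118)/(121), (103), (75), (44), scaling, (46), (54))
    (𝒢 : GaugeField P j SU2 → (𝒵 →L[ℂ] 𝒴)) (W𝒱 : GaugeField P j SU2 → 𝒴 → 𝒵) {B₀ C₄ a₃ b ε₄ : ℝ}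
    (h𝒢 : ∀ V f, ‖𝒢 V f‖ ≤ B₀ * ‖f‖) (hW : ∀ V, Prop4Hyp (W𝒱 V) C₄ a₃) (hB₀ : 0 < B₀) (hC₄ : 0 ≤ C₄)
    (hε₄ : 0 ≤ ε₄) (hdom : 2 * (ε₄ + B₀ * b) ≤ a₃) (hself : B₀ * C₄ * (ε₄ + B₀ * b) ^ 2 ≤ ε₄)
    (hcontr : 4 * B₀ * C₄ * (ε₄ + B₀ * b) < 1)
    (H₁ : GaugeField P j SU2 → (ℬ →L[ℂ] 𝒴)) (hH₁ : ∀ V B, ‖H₁ V B‖ ≤ B₀ * ‖B‖)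
    (Φ : GaugeField P j SU2 → (Fin n → ℂ) → ℬ) {rΦ : ℝ} (hΦd : ∀ V, DifferentiableOn ℂ (Φ V) (ball 0 rΦ))
    (hΦ0 : ∀ V, Φ V 0 = 0) (hΦ : ∀ V, ∀ z ∈ ball (0 : Fin n → ℂ) rΦ, ‖Φ V z‖ < b) (hSr : S < rΦ)
    (Cf : GaugeField P j SU2 → 𝒴' → 𝒳) {C₂ RC : ℝ} (hC₂ : 0 ≤ C₂)
    (hCq : ∀ V, ∀ Z : 𝒴', ‖Z‖ < RC → ‖Cf V Z‖ ≤ C₂ * ‖Z‖ ^ 2) (hCd : ∀ V, DifferentiableOn ℂ (Cf V) (ball 0 RC))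
    (ιs : GaugeField P j SU2 → (𝒴 →L[ℂ] 𝒴')) (hι : ∀ V Y, ‖ιs V Y‖ ≤ ‖Y‖)
    (Hop : GaugeField P j SU2 → (𝒳 →L[ℂ] 𝒴)) (hH : ∀ V X, ‖Hop V X‖ ≤ B₀ * ‖X‖)
    (hq : 9 * C₂ * B₀ * (ε₄ + B₀ * b) < 1) (hRC : 3 * (ε₄ + B₀ * b) ≤ RC)
    -- the classifier read-outs (7″), the weight read-outs (file (B)), the per-term functionals (LD f4)
    (ℓs : ι → List (𝒴 →L[ℂ] A)) {κr : ℝ} (hκ : 0 ≤ κr) (hℓ : ∀ p ∈ Pu, ∀ ℓ ∈ ℓs p, ∀ Y, ‖ℓ Y‖ ≤ κr * ‖Y‖)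
    {m : ℕ} (hlen : ∀ p ∈ Pu, (ℓs p).length ≤ m)
    (ℓw : κ → List (𝒴 →L[ℂ] A)) {κw : ℝ} (hκw : 0 ≤ κw) (hℓw : ∀ p ∈ Pw, ∀ ℓ ∈ ℓw p, ∀ Y, ‖ℓ Y‖ ≤ κw * ‖Y‖)
    {mw : ℕ} (hlenw : ∀ p ∈ Pw, (ℓw p).length ≤ mw)
    {𝔱 : Type*} (I : Finset 𝔱) (Ef : GaugeField P j SU2 → 𝔱 → 𝒴 → ℂ) {rE : ℝ} {eb : 𝔱 → ℝ} {Hbar : ℝ}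
    (hEd : ∀ V, ∀ i ∈ I, DifferentiableOn ℂ (Ef V i) (ball 0 rE))
    (hEb : ∀ V, ∀ i ∈ I, ∀ Z ∈ ball (0 : 𝒴) rE, ‖Ef V i Z‖ ≤ eb i) (hsum : ∑ i ∈ I, 2 * eb i ≤ Hbar)
    (hcoupE : (ε₄ + B₀ * b) + B₀ * (4 * C₂ * (ε₄ + B₀ * b) ^ 2) ≤ rE)
    -- THE REAL STRUCTURE (file (A)) and the UNITARITY TYPE of the weight read-outs
    (𝓡𝒴 : AddSubgroup 𝒴) (h𝓡𝒴 : IsClosed (𝓡𝒴 : Set 𝒴)) (𝓡𝒵 : AddSubgroup 𝒵) (𝓡𝒴' : AddSubgroup 𝒴')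
    (𝓡𝒳 : AddSubgroup 𝒳) (h𝓡𝒳 : IsClosed (𝓡𝒳 : Set 𝒳)) (𝓡ℬ : AddSubgroup ℬ)
    (h𝒢r : ∀ V, ∀ f ∈ 𝓡𝒵, 𝒢 V f ∈ 𝓡𝒴) (hWr : ∀ V, ∀ Y ∈ 𝓡𝒴, W𝒱 V Y ∈ 𝓡𝒵)
    (hιr : ∀ V, ∀ Y ∈ 𝓡𝒴, ιs V Y ∈ 𝓡𝒴') (hHr : ∀ V, ∀ X ∈ 𝓡𝒳, Hop V X ∈ 𝓡𝒴)
    (hCr : ∀ V, ∀ Z ∈ 𝓡𝒴', Cf V Z ∈ 𝓡𝒳) (hH₁r : ∀ V, ∀ B ∈ 𝓡ℬ, H₁ V B ∈ 𝓡𝒴)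
    (hΦr : ∀ V, ∀ y : Fin n → ℝ, ‖y‖ ≤ S → Φ V (cplx y) ∈ 𝓡ℬ)
    (hℓr : ∀ p ∈ Pw, ∀ ℓ ∈ ℓw p, ∀ Y ∈ 𝓡𝒴, Ttr.τ (ℓ Y) = 0 ∧ ‖exp (ℓ Y)‖ ≤ 1)
    -- DICTIONARY (on the chart cube only): the block weight with the DEFINED weight words and non-Wilson term, the
    -- tested variable with the DEFINED classifier holonomies — all read-outs/terms of the SAME exponent field
    (hRdict : ∀ V, ∀ x ∈ cube n S,
      R V (expFibreChart Λ (c V) e x) = Jco V x * weight Ttr β Pw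
        (fun p => holOf (ℓw p) (fun y => landauExp (Cf V) (ιs V) (Hop V) (4 * C₂ * (ε₄ + B₀ * b) ^ 2)
          (solAt (𝒢 V) 0 (W𝒱 V) ε₄ (0 : 𝒵) (H₁ V (Φ V (cplx y))) + H₁ V (Φ V (cplx y)))))
        (fun y => (∑ i ∈ I, Ef V i (landauExp (Cf V) (ιs V) (Hop V) (4 * C₂ * (ε₄ + B₀ * b) ^ 2)
          (solAt (𝒢 V) 0 (W𝒱 V) ε₄ (0 : 𝒵) (H₁ V (Φ V (cplx y))) + H₁ V (Φ V (cplx y))))).re) x)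
    (hudict : ∀ V, ∀ x ∈ cube n S,
      u (fixTo T U₀ (updateFinset V Λ (expFibreChart Λ (c V) e x))) =
        classifier hPu (fun p => holOf (ℓs p) (fun y => landauExp (Cf V) (ιs V) (Hop V)
          (4 * C₂ * (ε₄ + B₀ * b) ^ 2)
          (solAt (𝒢 V) 0 (W𝒱 V) ε₄ (0 : 𝒵) (H₁ V (Φ V (cplx y))) + H₁ V (Φ V (cplx y))))) x)
    -- SM-L5/L6: kept co-tests supported in the window, centre-monotone; the window inside the chart ball
    (hJW : ∀ V x, Jco V x ≠ 0 → x ∈ W V)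
    (hJ : ∀ V x, ∀ a : ℝ, 0 ≤ a → Jco V x ≤ Jco V (Real.exp (-a) • x))
    (hWS : ∀ V, W V ⊆ closedBall (0 : Fin n → ℝ) S)
    -- numbers + the weight-side smallness `s̄ ≤ 1` + SM-L2 (SM) in the currency `Rad = r_Φ / S`
    (hθ : 0 < θ) (hδ0 : 0 ≤ δ) (hδ1 : δ < 1) (hρ0 : 0 ≤ ρ) (hρ : ρ ≤ (1 - δ) / 2) (hβ : 0 ≤ β)
    (hsw1 : mw * (κw * ((ε₄ + B₀ * b) + B₀ * (4 * C₂ * (ε₄ + B₀ * b) ^ 2))) ≤ 1)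
    (hSM : 36 * (Real.exp (m * (κr * ((ε₄ + B₀ * b) + B₀ * (4 * C₂ * (ε₄ + B₀ * b) ^ 2)))) - 1) * 1 ^ 2 /
      (rΦ / S - 1) ^ 2 ≤ δ * θ) :
    SlotAntiConcentration ((fieldMeasure P j SU2).withDensity F) u θ ρ
      (2 * ((n : ℝ) + (β * ∑ _p ∈ Pw,
        (mw * (3 * (κw * ((ε₄ + B₀ * b) + B₀ * (4 * C₂ * (ε₄ + B₀ * b) ^ 2))) / (rΦ / S - 1))) *
          (0 + 4 * (mw * (κw * ((ε₄ + B₀ * b) + B₀ * (4 * C₂ * (ε₄ + B₀ * b) ^ 2))))) +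
        3 * Hbar / (rΦ / S - 1))) / (1 - δ)) := by
  have hRad : 1 < rΦ / S := by rw [lt_div_iff₀ hS]; linarith
  have hb : 0 < b := by
    obtain ⟨V⟩ : Nonempty (GaugeField P j SU2) := ⟨fun _ => 1⟩
    exact (norm_nonneg _).trans_lt (hΦ V 0 (mem_ball_self (hS.trans hSr)))
  have hz : 0 < (ε₄ + B₀ * b) + B₀ * (4 * C₂ * (ε₄ + B₀ * b) ^ 2) := by positivity
  have hs0 : 0 ≤ mw * (κw * ((ε₄ + B₀ * b) + B₀ * (4 * C₂ * (ε₄ + B₀ * b) ^ 2))) := by positivity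
  have hL0 : 0 ≤ mw * (3 * (κw * ((ε₄ + B₀ * b) + B₀ * (4 * C₂ * (ε₄ + B₀ * b) ^ 2))) / (rΦ / S - 1)) :=
    mul_nonneg (Nat.cast_nonneg _) (div_nonneg (by positivity) (by linarith))
  have hB𝓔 : 0 ≤ 3 * Hbar / (rΦ / S - 1) := by
    obtain ⟨V⟩ : Nonempty (GaugeField P j SU2) := ⟨fun _ => 1⟩
    exact hB𝓔_landau I hS hSr (hEb V) hsum hz hcoupE
  refine slotAC_realized_su2_of_levelData_cube_contOn hT U₀ Λ e hS hSπ c hR hF hFi hFw hfin hu hui Ttr hN hPu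
    (fun V p => holOf (ℓs p) (fun y => landauExp (Cf V) (ιs V) (Hop V) (4 * C₂ * (ε₄ + B₀ * b) ^ 2)
      (solAt (𝒢 V) 0 (W𝒱 V) ε₄ (0 : 𝒵) (H₁ V (Φ V (cplx y))) + H₁ V (Φ V (cplx y)))))
    (fun V p _ => continuousOn_landauHol_chartRay hS (h𝒢 V) (hW V) hB₀ hC₄ hε₄ hdom hself hcontr (H₁ V) (hH₁ V)
      (hΦd V) (hΦ V) hSr hC₂ (hCq V) (hCd V) (ιs V) (hι V) (Hop V) (hH V) hq hRC (ℓs p))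
    Pw
    (fun V p => holOf (ℓw p) (fun y => landauExp (Cf V) (ιs V) (Hop V) (4 * C₂ * (ε₄ + B₀ * b) ^ 2)
      (solAt (𝒢 V) 0 (W𝒱 V) ε₄ (0 : 𝒵) (H₁ V (Φ V (cplx y))) + H₁ V (Φ V (cplx y)))))
    (fun V y => (∑ i ∈ I, Ef V i (landauExp (Cf V) (ιs V) (Hop V) (4 * C₂ * (ε₄ + B₀ * b) ^ 2)
      (solAt (𝒢 V) 0 (W𝒱 V) ε₄ (0 : 𝒵) (H₁ V (Φ V (cplx y))) + H₁ V (Φ V (cplx y))))).re)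
    W Jco
    (sw := fun _ => mw * (κw * ((ε₄ + B₀ * b) + B₀ * (4 * C₂ * (ε₄ + B₀ * b) ^ 2))))
    (lw := fun _ => mw * (3 * (κw * ((ε₄ + B₀ * b) + B₀ * (4 * C₂ * (ε₄ + B₀ * b) ^ 2))) / (rΦ / S - 1)))
    (dw := fun _ => 0)
    hRdict hudict hJW hJ hRad (fun V => ?_) (fun V => ?_) (fun _ _ => hsw1) (fun _ _ => hs0) (fun _ _ => hL0)
    (fun _ _ => le_rfl) (fun V => ?_) hB𝓔 hθ hδ0 hδ1 hρ0 hρ hβ hSM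
  · exact hAN_landau_chartRay hS (hWS V) (h𝒢 V) (hW V) hB₀ hC₄ hε₄ hdom hself hcontr (H₁ V) (hH₁ V) (hΦd V)
      (hΦ0 V) (hΦ V) hSr hC₂ (hCq V) (hCd V) (ιs V) (hι V) (Hop V) (hH V) hq hRC ℓs hκ hℓ hlen
  · exact hGW_landau_chartRay Ttr hS (hWS V) (h𝒢 V) (hW V) hB₀ hC₄ hε₄ hdom hself hcontr (H₁ V) (hH₁ V) (hΦd V)
      (hΦ0 V) (hΦ V) hSr hC₂ (hCq V) (hCd V) (ιs V) (hι V) (Hop V) (hH V) hq hRC ℓw hκw hℓw hlenw 𝓡𝒴 h𝓡𝒴 𝓡𝒵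
      𝓡𝒴' 𝓡𝒳 h𝓡𝒳 𝓡ℬ (h𝒢r V) (hWr V) (hιr V) (hHr V) (hCr V) (hH₁r V) (hΦr V) hℓr
  · exact hE_landau_chartRay hS (hWS V) (h𝒢 V) (hW V) hB₀ hC₄ hε₄ hdom hself hcontr (H₁ V) (hH₁ V) (hΦd V)
      (hΦ0 V) (hΦ V) hSr hC₂ (hCq V) (hCd V) (ιs V) (hι V) (Hop V) (hH V) hq hRC I (hEd V) (hEb V) hsum hcoupE

end EndThree

end Summit.QuantumFields.BalabanUV.T4Continuum.ShellMeasureLandauHolonomyTermsEnd
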